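import Summits.QuantumFields.YangMills.Theorems.BalabanUVNodesN22W1StripAtRecord13
import Literature.MathematicalPhysics.QuantumFieldTheory.Balaban1983to89.Node00.HistoryTermIndexedGenerator

/-!
# BalabanUVNodes ∕ node N22 = NE9 — THE STRIP INDUCTION AT THE W1 OBJECT, MODULE 22′: THE LEAF AT NODE 00's GENERATOR IN PRINT'S TERM INDEX — every analytic input a
# statement about a TERM FUNCTIONAL `T Z (𝐃, P) g_k old φ` of [II] (2.14), for every `(𝐃, P) ∈ terms L M Z`: per-term locality, (2.26) per term in the complex older
# terms, (2.26) per term in the complex last coupling; NO index maps, NO abstract generator schema left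

Cell `pub-ymgap`, HUMAN RULING D-0062 (Track A), R134 ACCELERATION re-seat `pub-ymgap-dag-n22-c` (strategy s1), generation 5, module 22′.  THEOREMS ONLY; imports module 23′
`…N22W1StripAtRecord13` (transitively 19′ ∕ 20′ ∕ 21′: `n22At_u3OfRecord₁₂_ofRecordAdm_runTowers_toClusterTower_of_n18Below_threeSchemas`, `stepSchemaLast_of_termwise`, the
θ-form leaves and their Stage-13 twins) and node00-def-W1 g6's `Node00/HistoryTermIndexedGenerator` (p494929: `TermFun`, `GenTermFun`, `StepGen.ofTerms`, `GenTower.ofTerms`,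
`ofTerms_H`, `norm_H_ofTerms_le`, `differentiableOn_H_ofTerms`, `H_ofTerms_congr`) BY NAME.  `--supports` K3‴ `SpineGivenEndpointR13` (stmt-QuantumFields-19912) as a helper.

WHY.  Modules 19′–21′ reduced N22 on the s1 line to three PER-STEP schemas of an ABSTRACT one-step generator `Gn` (free index type, index maps `e` into print's term set).
NODE 00 has now typed the generator IN PRINT'S TERM INDEX: `StepGen.ofTerms L T` with indices `{Z} × terms L M Z` and generic term the TERM FUNCTIONAL `T` — so the
index maps disappear (`e := (·).2`, W1 g6's `snd_mem_terms_of_mem_idx` ∕ `injOn_snd_idx`; not even needed below: the complexified term values are the CANONICAL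
`Tt Z t z := T Z t …`) and each schema becomes a statement about `T Z t` for `t ∈ terms L M Z`: (S-loc-T) per-term locality in the older terms ⟹ (S-loc) (`H_ofTerms_congr`);
(S-226-T) ⟹ (S-226) (`differentiableOn_H_ofTerms` + `norm_H_ofTerms_le`, canonical `Tt`); (S-last-T) ⟹ (S-last) (21′ §2 `stepSchemaLast_of_termwise`, canonical `Tt`).

WHAT.
* §1 per step, for a term functional `T : TermFun (F.P k) 𝔸 M k′ L`: `stepSchemaLoc_ofTerms_of_termwise`, `stepSchema226_ofTerms_of_termwise`; per tower, for
  `TF : GenTermFun (F.P k) 𝔸 M L`: `stepSchemaLast_ofTerms_of_termwise` — the three schemas of 16′ ∕ 18′ AT `StepGen.ofTerms L T` ∕ `GenTower.ofTerms L TF` from their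
  per-term forms.
* §2 ★ `n22At_u3OfRecord₁₂_ofRecordAdm_runTowers_ofTerms_of_n18Below_termFun` — the θ-free engine: `N22At` at the admissible reading of record on the run towers generated
  by `fun k₁ ↦ GenTower.ofTerms L (TF k₁)` ⇐ node N18 below + `hspk` + numerals + signs + the three PER-TERM schemas of `TF k k′`, `k′ < k`.
* §3 ★ `s_N22_readingOfRecord₁₂_ofRecordAdm_runTowers_toClusterTower_of_s_N18_termFun` — THE ₁₂ LEAF: for a generator-valued map `Gn` (total in `θ`; the term-indexed
  generator needs `NeZero θ.τ9.M`, which only `θ.Admissible` grants), per `(F, θ, k)` under the provisos ∃(`NeZero θ.τ9.M`, `Sg`, `Rz`, `cs`, `c`, `L`, `NeZero L`, `a … r₁`,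
  a term functional `TF`): `Gn F θ k = GenTower.ofTerms L TF` ∧ `hspk` ∧ numerals ∧ (S-loc-T) ∧ (S-226-T) ∧ (S-last-T) per term; with `S_N18` and the signs ⟹ `S_N22`.
* §4 ★ `s_N22_rRec₁₃_pin_ofRecordAdm_runTowers_toClusterTower_of_s_N18_termFun` — its Stage-13 twin at any pinned `𝔯 : RateReading₁₃ N` (23′ §2 at `θ.toStage12Params`).

HONEST FRAMING.  Count-neutral by-name knit; NOT a discharge of N22.  The term functional is DATA: (S-loc-T) ∕ (S-226-T) ∕ (S-last-T) are DISPLAYED hypotheses on it — [II]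
(2.26) FOR ONE (2.14) TERM, complexified in the older terms (node N10's lane) ∕ in the last coupling (node N09's lane) — NOT PRINTED as such (print bounds real terms at real
couplings; [I] p. 263 ∕ p. 266 «(or analytic)»); the term functional OF RECORD (node00-def-B13's `ResidB13K.T₃` read through [II] §1 (1.33)∕(1.41)) is NODE 00's open junction;
`S_N18` is node N18's stub; numerals witnessed ∀ M by 17′ but the reading's; statements at `ofRecordAdm` vacuous where `AdmBg … k = ∅` (21′ §4 names the inhabited case).
NE9 NOT IN PRINT for d = 4; one finite four-torus programme at fixed ε — NOT infinite volume, NOT OS on ℝ⁴, NOT a mass gap, NOT Clay.  0 `sorry`, 0 `def`, standard axioms.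

References (TYPES only): [I] = [Balaban1987RG1] §1 p. 263, p. 266, (2.12)–(2.13) p. 268; [II] = [Balaban1988RG2Cluster] (2.1)–(2.3) p. 12, (2.9)–(2.15) pp. 14–15, (2.26)
p. 17, Lemma 3 (2.38) p. 20, (2.39)–(2.41) p. 21.
-/

noncomputable section

open scoped Matrix.Norms.L2Operator

namespace YMDAG.N22.W1

open Set Metric
open scoped BigOperators
open Literature.MathematicalPhysics.QuantumFieldTheory.Balaban1983to89
open Literature.MathematicalPhysics.QuantumFieldTheory.Balaban1983to89.T4Continuum
open Literature.MathematicalPhysics.QuantumFieldTheory.Balaban1983to89.T4OutputRate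
open Literature.MathematicalPhysics.QuantumFieldTheory.Balaban1983to89.TreeLengthTorus (TPt TDom tsys torusTreeLen torusTreeLen_nonneg)
open Literature.MathematicalPhysics.QuantumFieldTheory.Balaban1983to89.B12TreeDecay (K₀ K₀_pos)
open Literature.MathematicalPhysics.QuantumFieldTheory.Balaban1983to89.B13Lemma3TorusData (TBond)
open Literature.MathematicalPhysics.QuantumFieldTheory.Balaban1983to89.B13Lemma3TorusTerms (terms weight weight_nonneg)
open Literature.MathematicalPhysics.QuantumFieldTheory.Balaban1983to89.B13Lemma3TorusSocket (Lemma3Numerics)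
open Literature.MathematicalPhysics.QuantumFieldTheory.Balaban1983to89.Step (SFConsts)
open Literature.MathematicalPhysics.QuantumFieldTheory.Balaban1983to89.Node00
  (Stage12Params Stage13Params IsDatumOfRecord₁₂C IsDatumOfRecord₁₃C U3Objects₁₁ U3Letters₁₁ MatA ιSU prependCoupling)
open Literature.MathematicalPhysics.QuantumFieldTheory.Balaban1983to89.Node00.Sect2 (domSys domCount CPair ofBackgroundC spaceI domSites Setting Residual)
open Literature.MathematicalPhysics.QuantumFieldTheory.Balaban1983to89.Node00.W1
open YMDAG.UVSplit

variable {N : ℕ} [NeZero N]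

/-! ## §1 The three per-step schemas AT the term-indexed generator, from their per-term forms -/

section StepLevel

variable {F : T4Family} (k : ℕ) {𝔸 : Type*} [NormedRing 𝔸] [NormedAlgebra ℂ 𝔸] [CompleteSpace 𝔸] {G : Type*} [GaugeGroup G] {M : ℕ}
  (Sg : Setting 𝔸 G) (Rz : Residual (F.P k) 𝔸)

/-- **(S-loc) AT THE TERM-INDEXED GENERATOR FROM PER-TERM LOCALITY (S-loc-T).**  If every term `T Z t g old φ`, `t ∈ terms L M Z`, takes the same value at two older-terms
families agreeing on the space tables of record, so does the activity `H(Z) = Σ_{t ∈ terms L M Z} T Z t …` (W1's `H_ofTerms_congr`) — module 16′'s (S-loc) at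
`StepGen.ofTerms L T`. [cite: Balaban1988RG2Cluster, (2.9)-(2.11) p.14 and (2.14)-(2.15) p.15] -/
theorem stepSchemaLoc_ofTerms_of_termwise [NeZero M] {k' : ℕ} {L : ℕ} [NeZero L] (T : TermFun (F.P k) 𝔸 M k' L) {cs : SFConsts}
    (hlocT : ∀ (t : ℂ) (old old' : OlderTerms (F.P k) 𝔸 M k') (φ : CPair (F.P k) 𝔸) (Z : (domSys (F.P k) M (k' + 1)).Dom),
      (∀ (j : Fin (k' + 1)) (Y : (domSys (F.P k) M j).Dom) (ψ : CPair (F.P k) 𝔸), ψ ∈ spaceI Sg Rz M j (domSites (F.P k) M j Y) cs.α₀ cs.α₁ →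
        old j Y ψ = old' j Y ψ) →
      ∀ s ∈ terms L M Z, T Z s t old φ = T Z s t old' φ) :
    ∀ (t : ℂ) (old old' : OlderTerms (F.P k) 𝔸 M k') (φ : CPair (F.P k) 𝔸) (Z : (domSys (F.P k) M (k' + 1)).Dom),
      (∀ (j : Fin (k' + 1)) (Y : (domSys (F.P k) M j).Dom) (ψ : CPair (F.P k) 𝔸), ψ ∈ spaceI Sg Rz M j (domSites (F.P k) M j Y) cs.α₀ cs.α₁ →
        old j Y ψ = old' j Y ψ) →
      (StepGen.ofTerms L T).H t old φ Z = (StepGen.ofTerms L T).H t old' φ Z :=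
  fun t old old' φ Z h => H_ofTerms_congr L Z (hlocT t old old' φ Z h)

open Classical in
/-- **(S-226) AT THE TERM-INDEXED GENERATOR FROM THE PER-TERM SCHEMA (S-226-T)** — [II] (2.26) FOR ONE (2.14) TERM with COMPLEX OLDER TERMS on a common domain: for every
open `D ⊇` the closed `r`-discs about `]0, γ]`, real `s ∈ ]0, γ]`, older-terms curve `cv` with components on the space tables holomorphic + (1.18)-bounded on `D`, `X`,
`φ ∈ U^c_{k′+1}(X)`, `Z ⊆ X` and `t ∈ terms L M Z`, the term `z ↦ T Z t ↑s (cv z) φ` is holomorphic on `D` with `‖·‖ ≤ weight(t)·e^{a₅|Z|}` ⟹ module 16′'s (S-226) at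
`StepGen.ofTerms L T` with the CANONICAL complexified term values `Tt Z t z := T Z t ↑s (cv z) φ` (activity = their sum, `ofTerms_H`; holomorphy `differentiableOn_H_ofTerms`;
domination `norm_H_ofTerms_le`). [cite: Balaban1988RG2Cluster, (2.9)-(2.11) p.14, (2.14) p.15 and (2.26) p.17] -/
theorem stepSchema226_ofTerms_of_termwise [NeZero M] {k' : ℕ} {L : ℕ} [NeZero L] (T : TermFun (F.P k) 𝔸 M k' L) {cs : SFConsts} {γ r A κ : ℝ}
    (c : B13.Consts) {a a₅ : ℝ}
    (h226T : ∀ (D : Set ℂ), IsOpen D → (∀ t ∈ Ioc (0 : ℝ) γ, closedBall (t : ℂ) r ⊆ D) → ∀ (s : ℝ), s ∈ Ioc (0 : ℝ) γ →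
      ∀ (cv : ℂ → OlderTerms (F.P k) 𝔸 M k'),
      (∀ (j : Fin (k' + 1)) (Y : (domSys (F.P k) M j).Dom) (ψ : CPair (F.P k) 𝔸), ψ ∈ spaceI Sg Rz M j (domSites (F.P k) M j Y) cs.α₀ cs.α₁ →
        DifferentiableOn ℂ (fun z => cv z j Y ψ) D ∧ ∀ z ∈ D, ‖cv z j Y ψ‖ ≤ A * Real.exp (-(κ * torusTreeLen Y.1))) →
      ∀ (X : (domSys (F.P k) M (k' + 1)).Dom) (φ : CPair (F.P k) 𝔸), φ ∈ spaceI Sg Rz M (k' + 1) (domSites (F.P k) M (k' + 1) X) cs.α₀ cs.α₁ →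
      ∀ (Z : (domSys (F.P k) M (k' + 1)).Dom), Z.1 ⊆ X.1 → ∀ t ∈ terms L M Z,
        DifferentiableOn ℂ (fun z => T Z t (s : ℂ) (cv z) φ) D ∧
        ∀ z ∈ D, ‖T Z t (s : ℂ) (cv z) φ‖ ≤ weight L M c Z a t * Real.exp (a₅ * ((Z.1).card : ℝ))) :
    ∀ (D : Set ℂ), IsOpen D → (∀ t ∈ Ioc (0 : ℝ) γ, closedBall (t : ℂ) r ⊆ D) → ∀ (s : ℝ), s ∈ Ioc (0 : ℝ) γ →
      ∀ (cv : ℂ → OlderTerms (F.P k) 𝔸 M k'),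
      (∀ (j : Fin (k' + 1)) (Y : (domSys (F.P k) M j).Dom) (ψ : CPair (F.P k) 𝔸), ψ ∈ spaceI Sg Rz M j (domSites (F.P k) M j Y) cs.α₀ cs.α₁ →
        DifferentiableOn ℂ (fun z => cv z j Y ψ) D ∧ ∀ z ∈ D, ‖cv z j Y ψ‖ ≤ A * Real.exp (-(κ * torusTreeLen Y.1))) →
      ∀ (X : (domSys (F.P k) M (k' + 1)).Dom) (φ : CPair (F.P k) 𝔸), φ ∈ spaceI Sg Rz M (k' + 1) (domSites (F.P k) M (k' + 1) X) cs.α₀ cs.α₁ →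
      ∃ Tt : (Z : TDom 4 (domCount (F.P k) M (k' + 1))) →
          Finset (TDom 4 (L * domCount (F.P k) M (k' + 1))) × Finset (TBond 4 M (L * domCount (F.P k) M (k' + 1))) → ℂ → ℂ,
        (∀ Z : (domSys (F.P k) M (k' + 1)).Dom, Z.1 ⊆ X.1 → DifferentiableOn ℂ (fun z => (StepGen.ofTerms L T).H (s : ℂ) (cv z) φ Z) D) ∧
        (∀ z ∈ D, ∀ Z : TDom 4 (domCount (F.P k) M (k' + 1)), Z.1 ⊆ X.1 →
          ‖(StepGen.ofTerms L T).H (s : ℂ) (cv z) φ Z‖ ≤ ∑ t ∈ terms L M Z, ‖Tt Z t z‖) ∧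
        (∀ z ∈ D, ∀ Z : TDom 4 (domCount (F.P k) M (k' + 1)), Z.1 ⊆ X.1 → ∀ t ∈ terms L M Z,
          ‖Tt Z t z‖ ≤ weight L M c Z a t * Real.exp (a₅ * ((Z.1).card : ℝ))) := by
  intro D hD hdisc s hs cv hcv X φ hφ
  have hT := h226T D hD hdisc s hs cv hcv X φ hφ
  exact ⟨fun Z t z => T Z t (s : ℂ) (cv z) φ,
    fun Z hZ => differentiableOn_H_ofTerms L T (fun _ => (s : ℂ)) cv (fun _ => φ) Z fun t ht => (hT Z hZ t ht).1,
    fun z _ Z _ => norm_H_ofTerms_le L T (s : ℂ) (cv z) φ Z,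
    fun z hz Z hZ t ht => (hT Z hZ t ht).2 z hz⟩

open Classical in
/-- **(S-last) AT THE TERM-INDEXED GENERATOR TOWER FROM THE PER-TERM LAST-COUPLING SCHEMA (S-last-T)** — [II] (2.26) FOR ONE (2.14) TERM with COMPLEX LAST COUPLING,
given (1.18)-size of the real older terms: at the steps `k′ < K`, for every older-terms family `old` there is an open `U ⊇` the closed `r`-discs about `]0, γ]` such that IF
`old` is (1.18)-bounded on the space tables THEN for every `X`, `φ ∈ U^c_{k′+1}(X)`, `Z ⊆ X`, `t ∈ terms L M Z` the term `z ↦ TF k′ Z t z old φ` is holomorphic on `U` with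
`‖·‖ ≤ weight(t)·e^{a₅|Z|}` ⟹ module 18′'s (S-last)_{k′<K} at `GenTower.ofTerms L TF` (21′ §2 `stepSchemaLast_of_termwise` — Lemma 3's resummation + S25 in the last coupling,
same domain — with the canonical `Tt Z t z := TF k′ Z t z old φ`). [cite: Balaban1988RG2Cluster, (2.14) p.15, (2.26) p.17, Lemma 3 p.20 and (2.39)-(2.41) p.21; Balaban1987RG1, §1 p.263] -/
theorem stepSchemaLast_ofTerms_of_termwise [NeZero M] {L : ℕ} [NeZero L] (TF : GenTermFun (F.P k) 𝔸 M L) (K : ℕ) (c : B13.Consts) (hL : 8 ≤ c.L)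
    (hLc : c.L = L) {a a₂ a₂' a₅ Aabs : ℝ} (hN : Lemma3Numerics c M ((c.L : ℝ) / 2) a a₂ a₂' a₅ Aabs)
    {cs : SFConsts} {γ r E₀ κ r₁ : ℝ} (hA0 : 0 ≤ c.C3act * c.ε₁) (hr₁ : 0 ≤ r₁) (hκ : κ ≤ r₁)
    (hrate : r₁ + 2 * (64 * Real.log 162) + 2 ≤ (1 - 8 * c.δ) * ((c.L : ℝ) / 2) * c.κ)
    (hsmall : c.C3act * c.ε₁ * Real.exp (5 * r₁ + 1) * K₀ 64 8 * 9 * 64 ≤ 1)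
    (hrenew : Real.exp 1 * 9 * 64 * K₀ 64 8 ^ 2 * (c.C3act * c.ε₁) ≤ E₀)
    (hlastT : ∀ (k' : ℕ), k' < K → ∀ (old : OlderTerms (F.P k) 𝔸 M k'), ∃ U : Set ℂ, IsOpen U ∧ (∀ t ∈ Ioc (0 : ℝ) γ, closedBall (t : ℂ) r ⊆ U) ∧
      ((∀ (j : Fin (k' + 1)) (Y : (domSys (F.P k) M j).Dom) (ψ : CPair (F.P k) 𝔸), ψ ∈ spaceI Sg Rz M j (domSites (F.P k) M j Y) cs.α₀ cs.α₁ →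
          ‖old j Y ψ‖ ≤ E₀ * Real.exp (-(κ * torusTreeLen Y.1))) →
        ∀ (X : (domSys (F.P k) M (k' + 1)).Dom) (φ : CPair (F.P k) 𝔸), φ ∈ spaceI Sg Rz M (k' + 1) (domSites (F.P k) M (k' + 1) X) cs.α₀ cs.α₁ →
          ∀ (Z : (domSys (F.P k) M (k' + 1)).Dom), Z.1 ⊆ X.1 → ∀ t ∈ terms L M Z,
            DifferentiableOn ℂ (fun z => TF k' Z t z old φ) U ∧
            ∀ z ∈ U, ‖TF k' Z t z old φ‖ ≤ weight L M c Z a t * Real.exp (a₅ * ((Z.1).card : ℝ)))) :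
    ∀ (k' : ℕ), k' < K → ∀ (old : OlderTerms (F.P k) 𝔸 M k'), ∃ U : Set ℂ, IsOpen U ∧ (∀ t ∈ Ioc (0 : ℝ) γ, closedBall (t : ℂ) r ⊆ U) ∧
      ((∀ (j : Fin (k' + 1)) (Y : (domSys (F.P k) M j).Dom) (ψ : CPair (F.P k) 𝔸), ψ ∈ spaceI Sg Rz M j (domSites (F.P k) M j Y) cs.α₀ cs.α₁ →
          ‖old j Y ψ‖ ≤ E₀ * Real.exp (-(κ * torusTreeLen Y.1))) →
        ∀ (X : (domSys (F.P k) M (k' + 1)).Dom) (φ : CPair (F.P k) 𝔸), φ ∈ spaceI Sg Rz M (k' + 1) (domSites (F.P k) M (k' + 1) X) cs.α₀ cs.α₁ →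
          DifferentiableOn ℂ (fun z => (GenTower.ofTerms L TF k').E z old φ X) U ∧
            ∀ z ∈ U, ‖(GenTower.ofTerms L TF k').E z old φ X‖ ≤ E₀ * Real.exp (-(κ * torusTreeLen X.1))) := by
  refine stepSchemaLast_of_termwise k Sg Rz (GenTower.ofTerms L TF) K c hL hLc hN hA0 hr₁ hκ hrate hsmall hrenew fun k' hk old => ?_
  obtain ⟨U, hU, hdisc, hcond⟩ := hlastT k' hk old
  refine ⟨U, hU, hdisc, fun hadm X φ hφ => ?_⟩
  have hT := hcond hadm X φ hφ
  exact ⟨fun Z t z => TF k' Z t z old φ,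
    fun Z hZ => differentiableOn_H_ofTerms L (TF k') (fun z => z) (fun _ => old) (fun _ => φ) Z fun t ht => (hT Z hZ t ht).1,
    fun z _ Z _ => norm_H_ofTerms_le L (TF k') z old φ Z,
    fun z hz Z hZ t ht => (hT Z hZ t ht).2 z hz⟩

end StepLevel

/-! ## §2 The θ-free engine on the run towers generated by a term-functional family -/

section TermFunReading

variable {F : T4Family} {M : ℕ} [NeZero M] {L : ℕ} [NeZero L] (TF : (k₁ : ℕ) → GenTermFun (F.P k₁) (MatA N) M L)
  (sp : (k j : ℕ) → (domSys (F.P k) M j).Dom → Set (CPair (F.P k) (MatA N)))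
  (gauge : (k : ℕ) → GaugeField (F.P k) 0 (Node00.SU N) → GaugeField (F.P k) 0 (Node00.SU N) → ℝ) (hg : ∀ k U U', 0 ≤ gauge k U U')
  (T₀ : (k : ℕ) → GaugeField (F.P (k + 1)) 0 (Node00.SU N) → GaugeField (F.P k) 0 (Node00.SU N))
  (hT₀ : ∀ (k : ℕ) (U : GaugeField (F.P (k + 1)) 0 (Node00.SU N)),
    (∀ (j : ℕ) (Y : (domSys (F.P (k + 1)) M j).Dom), ofBackgroundC (ιSU N) U ∈ sp (k + 1) j Y) →
    ∀ (j : ℕ) (Y : (domSys (F.P k) M j).Dom), ofBackgroundC (ιSU N) (T₀ k U) ∈ sp k j Y)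
  (li : LetterInputs) (θ : Stage12Params F N) (k : ℕ) {G : Type*} [GaugeGroup G]
  (Sg : Setting (MatA N) G) (Rz : Residual (F.P k) (MatA N))

open Classical in
/-- **`N22At` AT THE ADMISSIBLE READING OF RECORD ON THE RUN TOWERS GENERATED BY A TERM-FUNCTIONAL FAMILY `TF`, FROM THREE PER-TERM SCHEMAS** (19′ §3 at
`Gn := fun k₁ ↦ GenTower.ofTerms L (TF k₁)`, its three per-step schemas SUPPLIED by §1): at the steps `k′ < k` of the `k`-th torus, for the terms `t ∈ terms L M Z` of
`TF k k′ Z t`: (S-loc-T) per-term locality in the older terms + (S-226-T) [II] (2.26) per term in the COMPLEX OLDER TERMS (node N10's lane) + (S-last-T) [II] (2.26) per term in the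
COMPLEX LAST COUPLING given (1.18)-size of the real older terms (node N09's lane) —, node N18 below, the `hspk` inclusion, the socket numerals + S25 + renewal, the letter signs ⟹
`N22At (u3OfRecord₁₂ θ (Dr.u3Objects θ.γ) k)`. [cite: Balaban1988RG2Cluster, (2.9)-(2.15) pp.14-15, (2.26) p.17, Lemma 3 p.20 and (2.39)-(2.41) p.21; Balaban1987RG1, §1 p.263 and (2.12)-(2.13) p.268] -/
theorem n22At_u3OfRecord₁₂_ofRecordAdm_runTowers_ofTerms_of_n18Below_termFun {cs : SFConsts}
    (hspk : ∀ (j : ℕ) (Y : (domSys (F.P k) M j).Dom), sp k j Y ⊆ spaceI Sg Rz M j (domSites (F.P k) M j Y) cs.α₀ cs.α₁)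
    (c : B13.Consts) (hL : 8 ≤ c.L) (hLc : c.L = L) {a a₂ a₂' a₅ Aabs : ℝ}
    (hN : Lemma3Numerics c M ((c.L : ℝ) / 2) a a₂ a₂' a₅ Aabs) {r₁ : ℝ} (hA0 : 0 ≤ c.C3act * c.ε₁) (hr₁ : 0 ≤ r₁) (hκ : li.κ ≤ r₁)
    (hrate : r₁ + 2 * (64 * Real.log 162) + 2 ≤ (1 - 8 * c.δ) * ((c.L : ℝ) / 2) * c.κ)
    (hsmall : c.C3act * c.ε₁ * Real.exp (5 * r₁ + 1) * K₀ 64 8 * 9 * 64 ≤ 1)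
    (hrenew : Real.exp 1 * 9 * 64 * K₀ 64 8 ^ 2 * (c.C3act * c.ε₁) ≤ li.A)
    (hlocT : ∀ (k' : ℕ), k' < k → ∀ (t : ℂ) (old old' : OlderTerms (F.P k) (MatA N) M k') (φ : CPair (F.P k) (MatA N))
      (Z : (domSys (F.P k) M (k' + 1)).Dom),
      (∀ (j : Fin (k' + 1)) (Y : (domSys (F.P k) M j).Dom) (ψ : CPair (F.P k) (MatA N)), ψ ∈ spaceI Sg Rz M j (domSites (F.P k) M j Y) cs.α₀ cs.α₁ →
        old j Y ψ = old' j Y ψ) →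
      ∀ s ∈ terms L M Z, TF k k' Z s t old φ = TF k k' Z s t old' φ)
    (h226T : ∀ (k' : ℕ), k' < k → ∀ (D : Set ℂ), IsOpen D → (∀ t ∈ Ioc (0 : ℝ) θ.γ, closedBall (t : ℂ) li.r ⊆ D) → ∀ (s : ℝ), s ∈ Ioc (0 : ℝ) θ.γ →
      ∀ (cv : ℂ → OlderTerms (F.P k) (MatA N) M k'),
      (∀ (j : Fin (k' + 1)) (Y : (domSys (F.P k) M j).Dom) (ψ : CPair (F.P k) (MatA N)), ψ ∈ spaceI Sg Rz M j (domSites (F.P k) M j Y) cs.α₀ cs.α₁ →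
        DifferentiableOn ℂ (fun z => cv z j Y ψ) D ∧ ∀ z ∈ D, ‖cv z j Y ψ‖ ≤ li.A * Real.exp (-(li.κ * torusTreeLen Y.1))) →
      ∀ (X : (domSys (F.P k) M (k' + 1)).Dom) (φ : CPair (F.P k) (MatA N)), φ ∈ spaceI Sg Rz M (k' + 1) (domSites (F.P k) M (k' + 1) X) cs.α₀ cs.α₁ →
      ∀ (Z : (domSys (F.P k) M (k' + 1)).Dom), Z.1 ⊆ X.1 → ∀ t ∈ terms L M Z,
        DifferentiableOn ℂ (fun z => TF k k' Z t (s : ℂ) (cv z) φ) D ∧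
        ∀ z ∈ D, ‖TF k k' Z t (s : ℂ) (cv z) φ‖ ≤ weight L M c Z a t * Real.exp (a₅ * ((Z.1).card : ℝ)))
    (hlastT : ∀ (k' : ℕ), k' < k → ∀ (old : OlderTerms (F.P k) (MatA N) M k'), ∃ U : Set ℂ, IsOpen U ∧ (∀ t ∈ Ioc (0 : ℝ) θ.γ, closedBall (t : ℂ) li.r ⊆ U) ∧
      ((∀ (j : Fin (k' + 1)) (Y : (domSys (F.P k) M j).Dom) (ψ : CPair (F.P k) (MatA N)), ψ ∈ spaceI Sg Rz M j (domSites (F.P k) M j Y) cs.α₀ cs.α₁ →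
          ‖old j Y ψ‖ ≤ li.A * Real.exp (-(li.κ * torusTreeLen Y.1))) →
        ∀ (X : (domSys (F.P k) M (k' + 1)).Dom) (φ : CPair (F.P k) (MatA N)), φ ∈ spaceI Sg Rz M (k' + 1) (domSites (F.P k) M (k' + 1) X) cs.α₀ cs.α₁ →
          ∀ (Z : (domSys (F.P k) M (k' + 1)).Dom), Z.1 ⊆ X.1 → ∀ t ∈ terms L M Z,
            DifferentiableOn ℂ (fun z => TF k k' Z t z old φ) U ∧
            ∀ z ∈ U, ‖TF k k' Z t z old φ‖ ≤ weight L M c Z a t * Real.exp (a₅ * ((Z.1).card : ℝ))))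
    (h18 : ∀ k' : ℕ, k' < k →
      N18At (u3OfRecord₁₂ θ ((ReadingData.ofRecordAdm F M N (runTowers fun k₁ => toClusterTower (GenTower.ofTerms L (TF k₁))) sp gauge hg T₀ hT₀ li).u3Objects
        θ.γ) k'))
    (hC5 : 0 ≤ li.C₅) (hθ1 : li.θ₅ < 1) (hC₀' : 2 * li.C₅ / (1 - li.θ₅) ≤ li.C₀)
    (hC₀ : 0 < li.C₀) (hθ : 0 < li.θ₅) (hA : 0 < li.A) (hμ1 : 1 ≤ li.μ) (hθμ : li.θ₅ ≤ li.μ) (hCM : li.C₀ ≤ 2 * li.A)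
    (hr : 0 < li.r) (hγ : 0 < θ.γ) (hs0 : 0 < li.s) (hs1 : li.s < 1) :
    N22At (u3OfRecord₁₂ θ ((ReadingData.ofRecordAdm F M N (runTowers fun k₁ => toClusterTower (GenTower.ofTerms L (TF k₁))) sp gauge hg T₀ hT₀ li).u3Objects
      θ.γ) k) :=
  n22At_u3OfRecord₁₂_ofRecordAdm_runTowers_toClusterTower_of_n18Below_threeSchemas (fun k₁ => GenTower.ofTerms L (TF k₁)) sp gauge hg T₀ hT₀ li θ k Sg Rz hspk c
    hL hLc hN hA0 hr₁ hκ hrate hsmall hrenew (fun k' hk => stepSchemaLoc_ofTerms_of_termwise k Sg Rz (TF k k') (hlocT k' hk))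
    (fun k' hk => stepSchema226_ofTerms_of_termwise k Sg Rz (TF k k') c (h226T k' hk))
    (stepSchemaLast_ofTerms_of_termwise k Sg Rz (TF k) k c hL hLc hN hA0 hr₁ hκ hrate hsmall hrenew hlastT) h18 hC5 hθ1 hC₀' hC₀ hθ hA hμ1 hθμ hCM hr hγ hs0 hs1

end TermFunReading

/-! ## §3 THE ₁₂ LEAF at a generator identified, per `(F, θ, k)` under the provisos, with a term-indexed one -/

section TermFunEdge

variable (Gn : (F : T4Family) → (θ : Stage12Params F N) → (k : ℕ) → GenTower (F.P k) (MatA N) θ.τ9.M)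
  (sp : (F : T4Family) → (θ : Stage12Params F N) → (k j : ℕ) → (domSys (F.P k) θ.τ9.M j).Dom → Set (CPair (F.P k) (MatA N)))
  (gauge : (F : T4Family) → (θ : Stage12Params F N) → (k : ℕ) → GaugeField (F.P k) 0 (Node00.SU N) → GaugeField (F.P k) 0 (Node00.SU N) → ℝ)
  (hg : ∀ (F : T4Family) (θ : Stage12Params F N) (k : ℕ) (U U' : GaugeField (F.P k) 0 (Node00.SU N)), 0 ≤ gauge F θ k U U')
  (T₀ : (F : T4Family) → (θ : Stage12Params F N) → (k : ℕ) → GaugeField (F.P (k + 1)) 0 (Node00.SU N) → GaugeField (F.P k) 0 (Node00.SU N))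
  (hT : ∀ (F : T4Family) (θ : Stage12Params F N) (k : ℕ) (U : GaugeField (F.P (k + 1)) 0 (Node00.SU N)),
    (∀ (j : ℕ) (Y : (domSys (F.P (k + 1)) θ.τ9.M j).Dom), ofBackgroundC (ιSU N) U ∈ sp F θ (k + 1) j Y) →
      ∀ (j : ℕ) (X : (domSys (F.P k) θ.τ9.M j).Dom), ofBackgroundC (ιSU N) (T₀ F θ k U) ∈ sp F θ k j X)
  (li : (F : T4Family) → Stage12Params F N → LetterInputs) (ℓ₃ : T4Family → Node00.NE3Letters₁₁)
  (ne2 : (F : T4Family) → Stage12Params F N → (ℕ → ℝ) → List (ULoop F) → ℕ → Node00.NE2Objects₁₁)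
  (ne1 : (F : T4Family) → Stage12Params F N → (ℕ → ℝ) → List (ULoop F) → NE1pCarriers) {G : Type*} [GaugeGroup G]

open Classical in
/-- **THE EDGE N18 → N22 AT THE ADMISSIBLE READING OF RECORD ON THE GENERATED TOWERS OF THE RUNS OF RECORD — THE GENERATOR IN PRINT'S TERM INDEX, EVERY ANALYTIC INPUT A
STATEMENT ABOUT ONE (2.14) TERM.**  `Gn` is a generator-valued map (total in `θ`; NODE 00's term-indexed generator needs `NeZero θ.τ9.M`, which only `θ.Admissible` grants);
node N18's stub `S_N18 (RRec₁₂ 𝔯)` + the letter signs + per `(F, θ, k)` UNDER THE PROVISOS ∃(`NeZero θ.τ9.M`, `Sg`, `Rz`, `cs`, `c`, `L`, `NeZero L`, `a … r₁`, a TERM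
FUNCTIONAL `TF : GenTermFun (F.P k) (MatA N) θ.τ9.M L`): `Gn F θ k = GenTower.ofTerms L TF` ∧ `hspk` ∧ numerals ∧ for `k′ < k` and `t ∈ terms L θ.τ9.M Z`: (S-loc-T) per-term
locality in the older terms ∧ (S-226-T) [II] (2.26) per term with COMPLEX OLDER TERMS on a common domain (node N10) ∧ (S-last-T) [II] (2.26) per term with COMPLEX LAST COUPLING
given (1.18)-size of the real older terms (node N09) ⟹ node N22's stub `S_N22 (RRec₁₂ 𝔯)` at
`𝔯 = readingOfRecord₁₂ (fun F θ ↦ ReadingData.ofRecordAdm F θ.τ9.M N (runTowers fun k ↦ toClusterTower (Gn F θ k)) …) ℓ₃ ne2 ne1` (19′ §4 with the three schemas from §1,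
transported along the identification). [cite: Balaban1988RG2Cluster, (2.9)-(2.15) pp.14-15, (2.26) p.17, Lemma 3 p.20 and (2.39)-(2.41) p.21; Balaban1987RG1, §1 p.263 and (2.12)-(2.13) p.268] -/
theorem s_N22_readingOfRecord₁₂_ofRecordAdm_runTowers_toClusterTower_of_s_N18_termFun
    (h18 : S_N18 (RRec₁₂ (readingOfRecord₁₂
      (fun F θ => ReadingData.ofRecordAdm F θ.τ9.M N (runTowers fun k => toClusterTower (Gn F θ k)) (sp F θ) (gauge F θ) (hg F θ) (T₀ F θ) (hT F θ)
        (li F θ)) ℓ₃ ne2 ne1)))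
    (hnum : ∀ (F : T4Family) (θ : Stage12Params F N), θ.Provisos₁₂ F N → θ.Admissible F N →
      0 < (li F θ).C₀ ∧ 0 < (li F θ).θ₅ ∧ (li F θ).θ₅ < 1 ∧ 0 ≤ (li F θ).C₅ ∧ 2 * (li F θ).C₅ / (1 - (li F θ).θ₅) ≤ (li F θ).C₀ ∧ 0 < (li F θ).A ∧
        (li F θ).θ₅ ≤ (li F θ).μ ∧ (li F θ).C₀ ≤ 2 * (li F θ).A ∧ 0 < (li F θ).r ∧ 0 < (li F θ).s ∧ (li F θ).s < 1 ∧ 1 ≤ (li F θ).μ)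
    (hdata : ∀ (F : T4Family) (θ : Stage12Params F N), θ.Provisos₁₂ F N → θ.Admissible F N → ∀ (k : ℕ),
      ∃ (_ : NeZero θ.τ9.M) (Sg : Setting (MatA N) G) (Rz : Residual (F.P k) (MatA N))
        (cs : SFConsts) (c : B13.Consts) (L : ℕ) (_ : NeZero L) (a a₂ a₂' a₅ Aabs r₁ : ℝ) (TF : GenTermFun (F.P k) (MatA N) θ.τ9.M L),
        Gn F θ k = GenTower.ofTerms L TF ∧
        (∀ (j : ℕ) (Y : (domSys (F.P k) θ.τ9.M j).Dom), sp F θ k j Y ⊆ spaceI Sg Rz θ.τ9.M j (domSites (F.P k) θ.τ9.M j Y) cs.α₀ cs.α₁) ∧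
        8 ≤ c.L ∧ c.L = L ∧ Lemma3Numerics c θ.τ9.M ((c.L : ℝ) / 2) a a₂ a₂' a₅ Aabs ∧ 0 ≤ c.C3act * c.ε₁ ∧ 0 ≤ r₁ ∧ (li F θ).κ ≤ r₁ ∧
        r₁ + 2 * (64 * Real.log 162) + 2 ≤ (1 - 8 * c.δ) * ((c.L : ℝ) / 2) * c.κ ∧
        c.C3act * c.ε₁ * Real.exp (5 * r₁ + 1) * K₀ 64 8 * 9 * 64 ≤ 1 ∧
        Real.exp 1 * 9 * 64 * K₀ 64 8 ^ 2 * (c.C3act * c.ε₁) ≤ (li F θ).A ∧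
        (∀ (k' : ℕ), k' < k → ∀ (t : ℂ) (old old' : OlderTerms (F.P k) (MatA N) θ.τ9.M k') (φ : CPair (F.P k) (MatA N))
          (Z : (domSys (F.P k) θ.τ9.M (k' + 1)).Dom),
          (∀ (j : Fin (k' + 1)) (Y : (domSys (F.P k) θ.τ9.M j).Dom) (ψ : CPair (F.P k) (MatA N)),
            ψ ∈ spaceI Sg Rz θ.τ9.M j (domSites (F.P k) θ.τ9.M j Y) cs.α₀ cs.α₁ → old j Y ψ = old' j Y ψ) →
          ∀ s ∈ terms L θ.τ9.M Z, TF k' Z s t old φ = TF k' Z s t old' φ) ∧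
        (∀ (k' : ℕ), k' < k → ∀ (D : Set ℂ), IsOpen D → (∀ t ∈ Ioc (0 : ℝ) θ.γ, closedBall (t : ℂ) (li F θ).r ⊆ D) →
          ∀ (s : ℝ), s ∈ Ioc (0 : ℝ) θ.γ → ∀ (cv : ℂ → OlderTerms (F.P k) (MatA N) θ.τ9.M k'),
          (∀ (j : Fin (k' + 1)) (Y : (domSys (F.P k) θ.τ9.M j).Dom) (ψ : CPair (F.P k) (MatA N)),
            ψ ∈ spaceI Sg Rz θ.τ9.M j (domSites (F.P k) θ.τ9.M j Y) cs.α₀ cs.α₁ →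
            DifferentiableOn ℂ (fun z => cv z j Y ψ) D ∧ ∀ z ∈ D, ‖cv z j Y ψ‖ ≤ (li F θ).A * Real.exp (-((li F θ).κ * torusTreeLen Y.1))) →
          ∀ (X : (domSys (F.P k) θ.τ9.M (k' + 1)).Dom) (φ : CPair (F.P k) (MatA N)),
          φ ∈ spaceI Sg Rz θ.τ9.M (k' + 1) (domSites (F.P k) θ.τ9.M (k' + 1) X) cs.α₀ cs.α₁ →
          ∀ (Z : (domSys (F.P k) θ.τ9.M (k' + 1)).Dom), Z.1 ⊆ X.1 → ∀ t ∈ terms L θ.τ9.M Z,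
            DifferentiableOn ℂ (fun z => TF k' Z t (s : ℂ) (cv z) φ) D ∧
            ∀ z ∈ D, ‖TF k' Z t (s : ℂ) (cv z) φ‖ ≤ weight L θ.τ9.M c Z a t * Real.exp (a₅ * ((Z.1).card : ℝ))) ∧
        (∀ (k' : ℕ), k' < k → ∀ (old : OlderTerms (F.P k) (MatA N) θ.τ9.M k'), ∃ U : Set ℂ, IsOpen U ∧
          (∀ t ∈ Ioc (0 : ℝ) θ.γ, closedBall (t : ℂ) (li F θ).r ⊆ U) ∧
          ((∀ (j : Fin (k' + 1)) (Y : (domSys (F.P k) θ.τ9.M j).Dom) (ψ : CPair (F.P k) (MatA N)),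
              ψ ∈ spaceI Sg Rz θ.τ9.M j (domSites (F.P k) θ.τ9.M j Y) cs.α₀ cs.α₁ → ‖old j Y ψ‖ ≤ (li F θ).A * Real.exp (-((li F θ).κ * torusTreeLen Y.1))) →
            ∀ (X : (domSys (F.P k) θ.τ9.M (k' + 1)).Dom) (φ : CPair (F.P k) (MatA N)),
            φ ∈ spaceI Sg Rz θ.τ9.M (k' + 1) (domSites (F.P k) θ.τ9.M (k' + 1) X) cs.α₀ cs.α₁ →
            ∀ (Z : (domSys (F.P k) θ.τ9.M (k' + 1)).Dom), Z.1 ⊆ X.1 → ∀ t ∈ terms L θ.τ9.M Z,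
              DifferentiableOn ℂ (fun z => TF k' Z t z old φ) U ∧
              ∀ z ∈ U, ‖TF k' Z t z old φ‖ ≤ weight L θ.τ9.M c Z a t * Real.exp (a₅ * ((Z.1).card : ℝ))))) :
    S_N22 (RRec₁₂ (readingOfRecord₁₂
      (fun F θ => ReadingData.ofRecordAdm F θ.τ9.M N (runTowers fun k => toClusterTower (Gn F θ k)) (sp F θ) (gauge F θ) (hg F θ) (T₀ F θ) (hT F θ)
        (li F θ)) ℓ₃ ne2 ne1)) := by
  refine s_N22_readingOfRecord₁₂_ofRecordAdm_runTowers_toClusterTower_of_s_N18_threeSchemas (G := G) Gn sp gauge hg T₀ hT li ℓ₃ ne2 ne1 h18 hnum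
    fun F θ hP hθ k => ?_
  obtain ⟨hMz, Sg, Rz, cs, c, L, hLz, a, a₂, a₂', a₅, Aabs, r₁, TF, hGn, hspk, hL, hLc, hN, hA0, hr₁, hκ, hrate, hsmall, hrenew, hlocT, h226T, hlastT⟩ :=
    hdata F θ hP hθ k
  refine ⟨hMz, Sg, Rz, cs, c, L, hLz, a, a₂, a₂', a₅, Aabs, r₁, hspk, hL, hLc, hN, hA0, hr₁, hκ, hrate, hsmall, hrenew, ?_, ?_, ?_⟩
  · rw [hGn]
    exact fun k' hk => stepSchemaLoc_ofTerms_of_termwise k Sg Rz (TF k') (hlocT k' hk)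
  · rw [hGn]
    exact fun k' hk => stepSchema226_ofTerms_of_termwise k Sg Rz (TF k') c (h226T k' hk)
  · rw [hGn]
    exact stepSchemaLast_ofTerms_of_termwise k Sg Rz TF k c hL hLc hN hA0 hr₁ hκ hrate hsmall hrenew hlastT

end TermFunEdge

/-! ## §4 Its Stage-13 twin at any pinned Stage-13 reading -/

section TermFunEdge13

variable (𝔯 : RateReading₁₃ N) (Gn : (F : T4Family) → (θ : Stage13Params F N) → (k : ℕ) → GenTower (F.P k) (MatA N) θ.τ9.M)
  (sp : (F : T4Family) → (θ : Stage13Params F N) → (k j : ℕ) → (domSys (F.P k) θ.τ9.M j).Dom → Set (CPair (F.P k) (MatA N)))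
  (gauge : (F : T4Family) → (θ : Stage13Params F N) → (k : ℕ) → GaugeField (F.P k) 0 (Node00.SU N) → GaugeField (F.P k) 0 (Node00.SU N) → ℝ)
  (hg : ∀ (F : T4Family) (θ : Stage13Params F N) (k : ℕ) (U U' : GaugeField (F.P k) 0 (Node00.SU N)), 0 ≤ gauge F θ k U U')
  (T₀ : (F : T4Family) → (θ : Stage13Params F N) → (k : ℕ) → GaugeField (F.P (k + 1)) 0 (Node00.SU N) → GaugeField (F.P k) 0 (Node00.SU N))
  (hT : ∀ (F : T4Family) (θ : Stage13Params F N) (k : ℕ) (U : GaugeField (F.P (k + 1)) 0 (Node00.SU N)),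
    (∀ (j : ℕ) (Y : (domSys (F.P (k + 1)) θ.τ9.M j).Dom), ofBackgroundC (ιSU N) U ∈ sp F θ (k + 1) j Y) →
      ∀ (j : ℕ) (X : (domSys (F.P k) θ.τ9.M j).Dom), ofBackgroundC (ιSU N) (T₀ F θ k U) ∈ sp F θ k j X)
  (li : (F : T4Family) → Stage13Params F N → LetterInputs) {G : Type*} [GaugeGroup G]

open Classical in
/-- **STAGE-13 TWIN OF §3 — THE EDGE N18 → N22 AT A READING PINNED AT THE ADMISSIBLE READING OF RECORD ON THE GENERATED TOWERS OF THE RUNS OF RECORD, THE GENERATOR IN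
PRINT'S TERM INDEX**: for any `𝔯 : RateReading₁₃ N` with `hpin`, node N18's stub `S_N18 (RRec₁₃ 𝔯)` + the letter signs + per `(F, θ, k)` under the Stage-13 provisos
∃(`NeZero θ.τ9.M`, `Sg`, `Rz`, `cs`, `c`, `L`, `NeZero L`, `a … r₁`, `TF`): `Gn F θ k = GenTower.ofTerms L TF` ∧ `hspk` ∧ numerals ∧ (S-loc-T) ∧ (S-226-T) ∧ (S-last-T) per
term ⟹ node N22's stub `S_N22 (RRec₁₃ 𝔯)` (23′ §2 with the three schemas from §1, transported along the identification). [cite: Balaban1988RG2Cluster, (2.9)-(2.15) pp.14-15, (2.26) p.17, Lemma 3 p.20 and (2.39)-(2.41) p.21; Balaban1987RG1, §1 p.263 and (2.12)-(2.13) p.268] -/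
theorem s_N22_rRec₁₃_pin_ofRecordAdm_runTowers_toClusterTower_of_s_N18_termFun
    (hpin : ∀ (F : T4Family) (θ : Stage13Params F N) (hP : θ.Provisos₁₃ F N) (g₀ : ℕ → ℝ) (os : List (ULoop F)), (𝔯.lit F θ hP g₀ os).u3 =
      (ReadingData.ofRecordAdm F θ.τ9.M N (runTowers fun k => toClusterTower (Gn F θ k)) (sp F θ) (gauge F θ) (hg F θ) (T₀ F θ) (hT F θ) (li F θ)).u3Objects θ.γ)
    (h18 : S_N18 (RRec₁₃ 𝔯))
    (hnum : ∀ (F : T4Family) (θ : Stage13Params F N), θ.Provisos₁₃ F N → θ.Admissible F N →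
      0 < (li F θ).C₀ ∧ 0 < (li F θ).θ₅ ∧ (li F θ).θ₅ < 1 ∧ 0 ≤ (li F θ).C₅ ∧ 2 * (li F θ).C₅ / (1 - (li F θ).θ₅) ≤ (li F θ).C₀ ∧ 0 < (li F θ).A ∧
        (li F θ).θ₅ ≤ (li F θ).μ ∧ (li F θ).C₀ ≤ 2 * (li F θ).A ∧ 0 < (li F θ).r ∧ 0 < (li F θ).s ∧ (li F θ).s < 1 ∧ 1 ≤ (li F θ).μ)
    (hdata : ∀ (F : T4Family) (θ : Stage13Params F N), θ.Provisos₁₃ F N → θ.Admissible F N → ∀ (k : ℕ),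
      ∃ (_ : NeZero θ.τ9.M) (Sg : Setting (MatA N) G) (Rz : Residual (F.P k) (MatA N))
        (cs : SFConsts) (c : B13.Consts) (L : ℕ) (_ : NeZero L) (a a₂ a₂' a₅ Aabs r₁ : ℝ) (TF : GenTermFun (F.P k) (MatA N) θ.τ9.M L),
        Gn F θ k = GenTower.ofTerms L TF ∧
        (∀ (j : ℕ) (Y : (domSys (F.P k) θ.τ9.M j).Dom), sp F θ k j Y ⊆ spaceI Sg Rz θ.τ9.M j (domSites (F.P k) θ.τ9.M j Y) cs.α₀ cs.α₁) ∧
        8 ≤ c.L ∧ c.L = L ∧ Lemma3Numerics c θ.τ9.M ((c.L : ℝ) / 2) a a₂ a₂' a₅ Aabs ∧ 0 ≤ c.C3act * c.ε₁ ∧ 0 ≤ r₁ ∧ (li F θ).κ ≤ r₁ ∧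
        r₁ + 2 * (64 * Real.log 162) + 2 ≤ (1 - 8 * c.δ) * ((c.L : ℝ) / 2) * c.κ ∧
        c.C3act * c.ε₁ * Real.exp (5 * r₁ + 1) * K₀ 64 8 * 9 * 64 ≤ 1 ∧
        Real.exp 1 * 9 * 64 * K₀ 64 8 ^ 2 * (c.C3act * c.ε₁) ≤ (li F θ).A ∧
        (∀ (k' : ℕ), k' < k → ∀ (t : ℂ) (old old' : OlderTerms (F.P k) (MatA N) θ.τ9.M k') (φ : CPair (F.P k) (MatA N))
          (Z : (domSys (F.P k) θ.τ9.M (k' + 1)).Dom),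
          (∀ (j : Fin (k' + 1)) (Y : (domSys (F.P k) θ.τ9.M j).Dom) (ψ : CPair (F.P k) (MatA N)),
            ψ ∈ spaceI Sg Rz θ.τ9.M j (domSites (F.P k) θ.τ9.M j Y) cs.α₀ cs.α₁ → old j Y ψ = old' j Y ψ) →
          ∀ s ∈ terms L θ.τ9.M Z, TF k' Z s t old φ = TF k' Z s t old' φ) ∧
        (∀ (k' : ℕ), k' < k → ∀ (D : Set ℂ), IsOpen D → (∀ t ∈ Ioc (0 : ℝ) θ.γ, closedBall (t : ℂ) (li F θ).r ⊆ D) →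
          ∀ (s : ℝ), s ∈ Ioc (0 : ℝ) θ.γ → ∀ (cv : ℂ → OlderTerms (F.P k) (MatA N) θ.τ9.M k'),
          (∀ (j : Fin (k' + 1)) (Y : (domSys (F.P k) θ.τ9.M j).Dom) (ψ : CPair (F.P k) (MatA N)),
            ψ ∈ spaceI Sg Rz θ.τ9.M j (domSites (F.P k) θ.τ9.M j Y) cs.α₀ cs.α₁ →
            DifferentiableOn ℂ (fun z => cv z j Y ψ) D ∧ ∀ z ∈ D, ‖cv z j Y ψ‖ ≤ (li F θ).A * Real.exp (-((li F θ).κ * torusTreeLen Y.1))) →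
          ∀ (X : (domSys (F.P k) θ.τ9.M (k' + 1)).Dom) (φ : CPair (F.P k) (MatA N)),
          φ ∈ spaceI Sg Rz θ.τ9.M (k' + 1) (domSites (F.P k) θ.τ9.M (k' + 1) X) cs.α₀ cs.α₁ →
          ∀ (Z : (domSys (F.P k) θ.τ9.M (k' + 1)).Dom), Z.1 ⊆ X.1 → ∀ t ∈ terms L θ.τ9.M Z,
            DifferentiableOn ℂ (fun z => TF k' Z t (s : ℂ) (cv z) φ) D ∧
            ∀ z ∈ D, ‖TF k' Z t (s : ℂ) (cv z) φ‖ ≤ weight L θ.τ9.M c Z a t * Real.exp (a₅ * ((Z.1).card : ℝ))) ∧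
        (∀ (k' : ℕ), k' < k → ∀ (old : OlderTerms (F.P k) (MatA N) θ.τ9.M k'), ∃ U : Set ℂ, IsOpen U ∧
          (∀ t ∈ Ioc (0 : ℝ) θ.γ, closedBall (t : ℂ) (li F θ).r ⊆ U) ∧
          ((∀ (j : Fin (k' + 1)) (Y : (domSys (F.P k) θ.τ9.M j).Dom) (ψ : CPair (F.P k) (MatA N)),
              ψ ∈ spaceI Sg Rz θ.τ9.M j (domSites (F.P k) θ.τ9.M j Y) cs.α₀ cs.α₁ → ‖old j Y ψ‖ ≤ (li F θ).A * Real.exp (-((li F θ).κ * torusTreeLen Y.1))) →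
            ∀ (X : (domSys (F.P k) θ.τ9.M (k' + 1)).Dom) (φ : CPair (F.P k) (MatA N)),
            φ ∈ spaceI Sg Rz θ.τ9.M (k' + 1) (domSites (F.P k) θ.τ9.M (k' + 1) X) cs.α₀ cs.α₁ →
            ∀ (Z : (domSys (F.P k) θ.τ9.M (k' + 1)).Dom), Z.1 ⊆ X.1 → ∀ t ∈ terms L θ.τ9.M Z,
              DifferentiableOn ℂ (fun z => TF k' Z t z old φ) U ∧
              ∀ z ∈ U, ‖TF k' Z t z old φ‖ ≤ weight L θ.τ9.M c Z a t * Real.exp (a₅ * ((Z.1).card : ℝ))))) :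
    S_N22 (RRec₁₃ 𝔯) := by
  refine s_N22_rRec₁₃_pin_ofRecordAdm_runTowers_toClusterTower_of_s_N18_threeSchemas 𝔯 (G := G) Gn sp gauge hg T₀ hT li hpin h18 hnum
    fun F θ hP hθ k => ?_
  obtain ⟨hMz, Sg, Rz, cs, c, L, hLz, a, a₂, a₂', a₅, Aabs, r₁, TF, hGn, hspk, hL, hLc, hN, hA0, hr₁, hκ, hrate, hsmall, hrenew, hlocT, h226T, hlastT⟩ :=
    hdata F θ hP hθ k
  refine ⟨hMz, Sg, Rz, cs, c, L, hLz, a, a₂, a₂', a₅, Aabs, r₁, hspk, hL, hLc, hN, hA0, hr₁, hκ, hrate, hsmall, hrenew, ?_, ?_, ?_⟩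
  · rw [hGn]
    exact fun k' hk => stepSchemaLoc_ofTerms_of_termwise k Sg Rz (TF k') (hlocT k' hk)
  · rw [hGn]
    exact fun k' hk => stepSchema226_ofTerms_of_termwise k Sg Rz (TF k') c (h226T k' hk)
  · rw [hGn]
    exact stepSchemaLast_ofTerms_of_termwise k Sg Rz TF k c hL hLc hN hA0 hr₁ hκ hrate hsmall hrenew hlastT

end TermFunEdge13

end YMDAG.N22.W1

end
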